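import Mathlib
import HarnessLib
import Summits.NavierStokesRegularity.NavierStokesRegularity.Theorems.HalfSpaceWindowDoorCirculationCarryingRigidityDefs
import Literature.Analysis.FluidPDE.OseenDuhamelPairCalculus
import Literature.Analysis.UnboundedOperators.HeatKernelHeatEquation
import Literature.Analysis.FluidPDE.VorticityCalculus

/-!
# Route `HalfSpaceWindowDoor`, crux `CirculationCarryingRigidity` (stmt-NavierStokesRegularity-25311) — census row:
# the door class is EMPTY BELOW THE LERAY FLOOR `16 C₀ C ≤ 1` (self-contained contraction proof)

LEAD ns-hsw-p1 g10 (cell pub-ns-dss).  A bookkeeping row of the census of the open research stub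
`stub_layerExclusion ≡ HemisphereLiouvilleE3` (W6): Leray's lower bound on the blow-up rate, run inside the route's Type-I
ancient Oseen-mild class (`InDoorClass C v`: time rate `‖v(t)‖_∞ ≤ C/√(−t)`, continuity, unit-viscosity Oseen–Duhamel
identity between negative times, divergence-free slices), by a CONTRACTION OF THE TYPE-I CONSTANT that uses only the two
sup-norm tools of the tree — the maximum principle for the caloric extension (`UnboundedOperators.norm_heatExtension_le`)
and KNSS's bilinear bound `‖B_s(a,b)(t)‖ ≤ C₀ M_a M_b · 2√(t − s)` (`norm_oseenDuhamel_le_const`, `C₀ = oseenSliceConst ℝ³`):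

* `typeI_improve` — the Oseen–Duhamel identity from `s = 4t` gives, for ANY door-class profile with time rate `D`,
  the improved rate `D/2 + 4 C₀ D²` (`‖e^{3(−t)Δ}v(4t)‖ ≤ D/(2√(−t))`, `‖B_{4t}(v,v)(t)‖ ≤ 2√3·C₀D²/√(−t)`);
* `typeI_iterate` — if `16 C₀ D ≤ 1` the improved rate is `≤ (3/4)D`, and the smallness persists: rate `(3/4)ⁿ D` for all `n`;
* `eq_zero_of_small_constant` — hence a door-class profile with `16 C₀ C ≤ 1` VANISHES IDENTICALLY (no sign hypothesis);
  `inner_curl_e3_eq_zero_of_small_constant`, `hemisphereLiouvilleE3_of_small_constant` (W6 restricted to `16 C₀ C ≤ 1`,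
  hypotheses of `HemisphereLiouvilleE3` verbatim) and `circulationCarryingRigidity_of_small_constant` (the crux restricted to
  `16 C₀ C ≤ 1`, every direction `e ≠ 0`; vacuous, the strict-positivity hypothesis being incompatible with `v ≡ 0`);
* `typeI_floor_of_ne_zero` — contrapositive: a door-class profile with one non-zero value has `16 C₀ C > 1`.

CENSUS READING: the Type-I constant of an enemy of W6 exceeds `1/(16 C₀)` — the door is empty below the Leray floor, and
smallness of `C` is never available as a perturbative parameter beyond that universal threshold (compare the `C`-dependent
rows of the census: `C(1+K) < 1` cone row, `C² < 2` spin-down row, tilting window `(2 ± 2C)M₀`).  (The route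
`ClockStretchingLaw` records the same floor for `IsTypeIAncientMild`, `…ClockCeilingLerayFloor`, by a continuity bootstrap; the
contraction argument here is import-light and self-contained.)

WHAT THIS IS NOT: not a statement about Navier–Stokes regularity (Clay A); the door statements concern HYPOTHETICAL blow-up
profiles (KNSS ancient mild solutions); helper `--supports` 25311; the item stays OPEN at its research stub; the mathematics is
Leray 1934 §19–21 / KNSS 2009 §4.
-/

noncomputable section

-- the summit and its single sub-problem share the name (CONVENTIONS §1), as in every Theorems file
set_option linter.dupNamespace false

namespace Summit.NavierStokesRegularity.NavierStokesRegularity.Theorems.HalfSpaceWindowDoorCirculationCarryingRigidityLerayFloor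

open Set Function Filter Topology
open scoped RealInnerProductSpace InnerProductSpace
open Literature.Analysis Literature.Analysis.FluidPDE
open Summit.NavierStokesRegularity.NavierStokesRegularity.Theses.HalfSpaceWindowDoor (CirculationCarryingRigidity)
open Summit.NavierStokesRegularity.NavierStokesRegularity.Theorems.HalfSpaceWindowDoorCirculationCarryingRigidityDefs
  (InDoorClass SignE3 e3 HemisphereLiouvilleE3)

variable {C : ℝ} {v : ℝ → EuclideanSpace ℝ (Fin 3) → EuclideanSpace ℝ (Fin 3)}

/-! ### The contraction step -/

/-- **One contraction step of the Type-I constant.**  If a door-class profile obeys the time rate `‖v(τ,y)‖ ≤ D/√(−τ)` for all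
`τ < 0`, then it obeys the rate `D/2 + 4 C₀ D²`: the Oseen–Duhamel identity from `s = 4t`, the maximum principle for the
caloric part (`D/√(−4t) = D/(2√(−t))`) and KNSS's bilinear bound with the slice bound `D/√(−t)` on `(4t, t)`
(`C₀ (D/√(−t))² · 2√(3(−t)) ≤ 4 C₀ D²/√(−t)`). [cite: KochNadirashviliSereginSverak2009, §4 p. 8 (arXiv:0709.3599)] -/
theorem typeI_improve (hv : InDoorClass C v) {D : ℝ} (hD : ∀ τ < 0, ∀ y, ‖v τ y‖ ≤ D / Real.sqrt (-τ)) :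
    ∀ t < 0, ∀ x, ‖v t x‖ ≤ (D / 2 + 4 * oseenSliceConst (EuclideanSpace ℝ (Fin 3)) * D ^ 2) / Real.sqrt (-t) := by
  intro t ht x
  have hC₀ : 0 < oseenSliceConst (EuclideanSpace ℝ (Fin 3)) := oseenSliceConst_pos
  have hst : 4 * t < t := by linarith
  have hsq : 0 < Real.sqrt (-t) := Real.sqrt_pos.2 (by linarith)
  have hD0 : 0 ≤ D := by
    have h := hD t ht x
    by_contra hneg
    push Not at hneg
    have : D / Real.sqrt (-t) < 0 := div_neg_of_neg_of_pos hneg hsq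
    linarith [norm_nonneg (v t x)]
  -- the Oseen–Duhamel identity from `s = 4t`
  have hmild := hv.2.2.1 (4 * t) t hst ht x
  -- the caloric part
  have hheat : ‖UnboundedOperators.heatExtension (v (4 * t)) (t - 4 * t) x‖ ≤ D / (2 * Real.sqrt (-t)) := by
    have hb : ∀ z, ‖v (4 * t) z‖ ≤ D / (2 * Real.sqrt (-t)) := by
      intro z
      have h := hD (4 * t) (by linarith) z
      have e : Real.sqrt (-(4 * t)) = 2 * Real.sqrt (-t) := by
        rw [show -(4 * t) = 2 ^ 2 * (-t) by ring, Real.sqrt_mul (by norm_num), Real.sqrt_sq (by norm_num)]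
      rwa [e] at h
    exact UnboundedOperators.norm_heatExtension_le hb (by linarith) x
  -- the bilinear part
  have hbil : ‖oseenDuhamel 1 (4 * t) v v t x‖ ≤ 4 * oseenSliceConst (EuclideanSpace ℝ (Fin 3)) * D ^ 2 / Real.sqrt (-t) := by
    have hslice : ∀ τ ∈ Ioo (4 * t) t, ∀ y, ‖v τ y‖ ≤ D / Real.sqrt (-t) := by
      intro τ hτ y
      have hτ0 : τ < 0 := hτ.2.trans ht
      refine (hD τ hτ0 y).trans ?_
      exact div_le_div_of_nonneg_left hD0 hsq (Real.sqrt_le_sqrt (by linarith [hτ.2]))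
    have h := norm_oseenDuhamel_le_const hst.le hslice hslice x
    have e3 : Real.sqrt (t - 4 * t) = Real.sqrt 3 * Real.sqrt (-t) := by
      rw [show t - 4 * t = 3 * (-t) by ring, Real.sqrt_mul (by norm_num)]
    have hs3 : Real.sqrt 3 ≤ 2 := by
      rw [show (2 : ℝ) = Real.sqrt (2 ^ 2) by rw [Real.sqrt_sq (by norm_num)]]
      exact Real.sqrt_le_sqrt (by norm_num)
    refine h.trans ?_
    rw [e3]
    have hsqt : Real.sqrt (-t) ^ 2 = -t := Real.sq_sqrt (by linarith)
    have e1 : oseenSliceConst (EuclideanSpace ℝ (Fin 3)) * (D / Real.sqrt (-t) * (D / Real.sqrt (-t))) *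
        (2 * (Real.sqrt 3 * Real.sqrt (-t))) =
        (2 * Real.sqrt 3) * (oseenSliceConst (EuclideanSpace ℝ (Fin 3)) * D ^ 2) / Real.sqrt (-t) := by
      field_simp
    rw [e1, div_le_div_iff_of_pos_right hsq]
    have : 0 ≤ oseenSliceConst (EuclideanSpace ℝ (Fin 3)) * D ^ 2 := by positivity
    nlinarith
  calc ‖v t x‖ = ‖UnboundedOperators.heatExtension (v (4 * t)) (t - 4 * t) x - oseenDuhamel 1 (4 * t) v v t x‖ := by
        rw [hmild]
    _ ≤ ‖UnboundedOperators.heatExtension (v (4 * t)) (t - 4 * t) x‖ + ‖oseenDuhamel 1 (4 * t) v v t x‖ :=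
        norm_sub_le _ _
    _ ≤ D / (2 * Real.sqrt (-t)) + 4 * oseenSliceConst (EuclideanSpace ℝ (Fin 3)) * D ^ 2 / Real.sqrt (-t) :=
        add_le_add hheat hbil
    _ = (D / 2 + 4 * oseenSliceConst (EuclideanSpace ℝ (Fin 3)) * D ^ 2) / Real.sqrt (-t) := by
        field_simp

/-- **Below the floor the contraction is by `3/4` and the smallness persists.** [folklore] -/
theorem typeI_contract (hv : InDoorClass C v) {D : ℝ} (hD0 : 0 ≤ D)
    (hDs : 16 * oseenSliceConst (EuclideanSpace ℝ (Fin 3)) * D ≤ 1)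
    (hD : ∀ τ < 0, ∀ y, ‖v τ y‖ ≤ D / Real.sqrt (-τ)) :
    ∀ t < 0, ∀ x, ‖v t x‖ ≤ (3 / 4 * D) / Real.sqrt (-t) := by
  intro t ht x
  have hC₀ : 0 < oseenSliceConst (EuclideanSpace ℝ (Fin 3)) := oseenSliceConst_pos
  have hsq : 0 < Real.sqrt (-t) := Real.sqrt_pos.2 (by linarith)
  refine (typeI_improve hv hD t ht x).trans (div_le_div_of_nonneg_right ?_ hsq.le)
  have : 4 * oseenSliceConst (EuclideanSpace ℝ (Fin 3)) * D ^ 2 ≤ D / 4 := by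
    have h1 : 4 * oseenSliceConst (EuclideanSpace ℝ (Fin 3)) * D ^ 2 = (16 * oseenSliceConst (EuclideanSpace ℝ (Fin 3)) * D) * (D / 4) := by
      ring
    rw [h1]
    exact mul_le_of_le_one_left (by positivity) hDs
  linarith

/-- **Iteration**: rate `(3/4)ⁿ C` for every `n`, as soon as `16 C₀ C ≤ 1`. [folklore] -/
theorem typeI_iterate (hv : InDoorClass C v) (hC : 16 * oseenSliceConst (EuclideanSpace ℝ (Fin 3)) * C ≤ 1) (n : ℕ) :
    ∀ t < 0, ∀ x, ‖v t x‖ ≤ ((3 / 4 : ℝ) ^ n * C) / Real.sqrt (-t) := by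
  have hC₀ : 0 < oseenSliceConst (EuclideanSpace ℝ (Fin 3)) := oseenSliceConst_pos
  have hC0 : 0 ≤ C := by
    have h := hv.1 (-1) (by norm_num) 0
    have : (0 : ℝ) ≤ C / Real.sqrt (-(-1 : ℝ)) := (norm_nonneg _).trans h
    simpa using this
  induction n with
  | zero =>
    intro t ht x
    simpa using hv.1 t ht x
  | succ n ih =>
    have hDn0 : 0 ≤ (3 / 4 : ℝ) ^ n * C := by positivity
    have hDns : 16 * oseenSliceConst (EuclideanSpace ℝ (Fin 3)) * ((3 / 4 : ℝ) ^ n * C) ≤ 1 := by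
      have hq : (3 / 4 : ℝ) ^ n ≤ 1 := pow_le_one₀ (by norm_num) (by norm_num)
      calc 16 * oseenSliceConst (EuclideanSpace ℝ (Fin 3)) * ((3 / 4 : ℝ) ^ n * C)
          = (3 / 4 : ℝ) ^ n * (16 * oseenSliceConst (EuclideanSpace ℝ (Fin 3)) * C) := by ring
        _ ≤ 1 * 1 := mul_le_mul hq hC (by positivity) (by norm_num)
        _ = 1 := by norm_num
    have h := typeI_contract hv hDn0 hDns ih
    intro t ht x
    have e : (3 / 4 : ℝ) ^ (n + 1) * C = 3 / 4 * ((3 / 4 : ℝ) ^ n * C) := by ring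
    rw [e]
    exact h t ht x

/-! ### The census row -/

/-- **A door-class profile with Type-I constant `16 C₀ C ≤ 1` vanishes identically** (no sign hypothesis): the rates
`(3/4)ⁿ C/√(−t)` tend to `0`. [cite: Leray1934, §19–21] [cite: KochNadirashviliSereginSverak2009, §4 p. 8 (arXiv:0709.3599)] -/
theorem eq_zero_of_small_constant (hv : InDoorClass C v)
    (hC : 16 * oseenSliceConst (EuclideanSpace ℝ (Fin 3)) * C ≤ 1) :
    ∀ t < 0, ∀ x, v t x = 0 := by
  intro t ht x
  have hlim : Tendsto (fun n : ℕ => ((3 / 4 : ℝ) ^ n * C) / Real.sqrt (-t)) atTop (𝓝 ((0 * C) / Real.sqrt (-t))) :=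
    ((tendsto_pow_atTop_nhds_zero_of_lt_one (by norm_num) (by norm_num)).mul_const C).div_const _
  rw [zero_mul, zero_div] at hlim
  have hle : ‖v t x‖ ≤ 0 :=
    ge_of_tendsto' hlim fun n => typeI_iterate hv hC n t ht x
  exact norm_le_zero_iff.1 hle

/-- **Contrapositive: the Leray floor of a non-zero door-class profile**, `16 C₀ C > 1`. [cite: Leray1934, §19–21] -/
theorem typeI_floor_of_ne_zero (hv : InDoorClass C v) (hne : ∃ t < 0, ∃ x, v t x ≠ 0) :
    1 < 16 * oseenSliceConst (EuclideanSpace ℝ (Fin 3)) * C := by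
  by_contra hle
  push Not at hle
  obtain ⟨t, ht, x, hx⟩ := hne
  exact hx (eq_zero_of_small_constant hv hle t ht x)

/-- **Below the floor every profile is poloidal** (indeed zero): `⟪curl v(s)(y), e₃⟫ = 0`. [folklore] -/
theorem inner_curl_e3_eq_zero_of_small_constant (hv : InDoorClass C v)
    (hC : 16 * oseenSliceConst (EuclideanSpace ℝ (Fin 3)) * C ≤ 1) :
    ∀ s < 0, ∀ y, ⟪curl (v s) y, e3⟫_ℝ = 0 := by
  intro s hs y
  have hz : v s = 0 := funext fun x => eq_zero_of_small_constant hv hC s hs x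
  rw [hz, curl_zero]
  simp

/-- **The Leray floor of a NON-POLOIDAL profile**: if `⟪curl v(s)(y), e₃⟫ ≠ 0` at one point of the open slab then
`16 C₀ C > 1` — the Type-I constant of an enemy of W6 is never small. [cite: Leray1934, §19–21] -/
theorem typeI_floor_of_not_poloidal (hv : InDoorClass C v) (hne : ∃ s < 0, ∃ y, ⟪curl (v s) y, e3⟫_ℝ ≠ 0) :
    1 < 16 * oseenSliceConst (EuclideanSpace ℝ (Fin 3)) * C := by
  by_contra hle
  push Not at hle
  obtain ⟨s, hs, y, hy⟩ := hne
  exact hy (inner_curl_e3_eq_zero_of_small_constant hv hle s hs y)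

/-- **W6 = `HemisphereLiouvilleE3` RESTRICTED TO `16 C₀ C ≤ 1`** (the hypotheses of `HemisphereLiouvilleE3` verbatim, plus the
smallness of the Type-I constant; the sign hypothesis is idle here). [cite: Leray1934, §19–21] -/
theorem hemisphereLiouvilleE3_of_small_constant (C : ℝ) (v : ℝ → EuclideanSpace ℝ (Fin 3) → EuclideanSpace ℝ (Fin 3))
    (hC : 16 * oseenSliceConst (EuclideanSpace ℝ (Fin 3)) * C ≤ 1)
    (hrate : HasTypeITimeDecay C v) (hcont : ContinuousOn (Function.uncurry v) (Set.Iio (0 : ℝ) ×ˢ Set.univ))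
    (hmild : ∀ s t : ℝ, s < t → t < 0 → ∀ x,
      v t x = UnboundedOperators.heatExtension (v s) (t - s) x - oseenDuhamel 1 s v v t x)
    (hdiv : ∀ t < 0, VectorCalculus.IsDivFree (v t))
    (_hsign : ∀ s < 0, ∀ y, 0 ≤ ⟪curl (v s) y, e3⟫_ℝ) :
    ∀ s < 0, ∀ y, ⟪curl (v s) y, e3⟫_ℝ = 0 :=
  inner_curl_e3_eq_zero_of_small_constant ⟨hrate, hcont, hmild, hdiv⟩ hC

/-- **The crux `CirculationCarryingRigidity` RESTRICTED TO `16 C₀ C ≤ 1`**, every direction `e ≠ 0` (the hypotheses of the route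
decl verbatim, plus the smallness of the Type-I constant): vacuous — the profile is zero, so no slice has a point of strictly
positive `⟪curl v(s)(y), e⟫`. [cite: Leray1934, §19–21] -/
theorem circulationCarryingRigidity_of_small_constant (C : ℝ) (v : ℝ → EuclideanSpace ℝ (Fin 3) → EuclideanSpace ℝ (Fin 3))
    (hC : 16 * oseenSliceConst (EuclideanSpace ℝ (Fin 3)) * C ≤ 1)
    (hrate : HasTypeITimeDecay C v) (hcont : ContinuousOn (Function.uncurry v) (Set.Iio (0 : ℝ) ×ˢ Set.univ))
    (hmild : ∀ s t : ℝ, s < t → t < 0 → ∀ x,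
      v t x = UnboundedOperators.heatExtension (v s) (t - s) x - oseenDuhamel 1 s v v t x)
    (hdiv : ∀ t < 0, VectorCalculus.IsDivFree (v t)) (e : EuclideanSpace ℝ (Fin 3)) (_he : e ≠ 0)
    (_hsign : ∀ s < 0, ∀ y, 0 ≤ ⟪curl (v s) y, e⟫_ℝ) (hpos : ∃ s, s < 0 ∧ ∃ y, 0 < ⟪curl (v s) y, e⟫_ℝ) :
    ¬ IsBackwardSingularPoint v 0 := by
  obtain ⟨s, hs, y, hy⟩ := hpos
  have hz : v s = 0 := funext fun x => eq_zero_of_small_constant ⟨hrate, hcont, hmild, hdiv⟩ hC s hs x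
  rw [hz, curl_zero] at hy
  simp at hy

end Summit.NavierStokesRegularity.NavierStokesRegularity.Theorems.HalfSpaceWindowDoorCirculationCarryingRigidityLerayFloor

end
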